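import Summits.QuantumFields.YangMills.Theorems.WeakCouplingRatesBoxHodge
import Literature.MathematicalPhysics.QuantumFieldTheory.PlaquetteChains
import Literature.MathematicalPhysics.QuantumFieldTheory.LatticeConvolution
import Literature.Probability.LatticeModels.LatticeGreenGradient

/-!
# Route `WeakCouplingRates`, crux `ColdBoxTwoPointFloorW`, stub S4 `stub_boxKernelVsLattice`: decay of the `ℤ⁴` curl
# kernel and of the co-potential of a plaquette point mass (sup-norm Lawler bounds)

Helper file 3/5 (fleet seat `ym-wcr-19608-p2`, item stmt-QuantumFields-19608, line `birth`, skeleton v5).  Inputs: the tree's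
Lawler bounds `latticeGreen_gradient_bound(_neg)` (`|∇G| = O(|x|⁻³)`) and `latticeGreen_second_diff_bound`
(`|∇∇G| = O(|x|⁻⁴)`) in `d = 4`, converted to the sup norm of `ℤ⁴`.

* `exists_d₂_greenTensor_bound` — `|(d₂ g_q)(y)| ≤ K_W/‖y − x_q‖³`; `exists_curl_greenTensor_bound` —
  `|(d₁ div₂ g_q)(y)| ≤ K_Z/‖y − x_q‖⁴` (`‖y − x_q‖ ≥ 3`); `div₃_d₂_greenTensor_of_ne` — off `q` the co-exact part is
  minus the curl part;
* (the ramp cut-off and the `O(H⁻⁴)` comparison are in `Theorems/WeakCouplingRatesBoxCutoff.lean`).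

No sorry, standard axioms; no new definition.  NOT a claim about the mass gap.
-/

set_option autoImplicit false

noncomputable section

open Finset
open Literature.Probability.LatticeModels
open Literature.MathematicalPhysics.QuantumLattice
open Literature.MathematicalPhysics.QuantumFieldTheory
open Literature.MathematicalPhysics.QuantumFieldTheory.LatticeChain
open Literature.MathematicalPhysics.QuantumFieldTheory.LatticeForm (e d₁ d₂)

namespace Summit.QuantumFields.YangMills.Theorems.WeakCouplingRates

/-! ## Sup norm versus Euclidean norm on `ℤ^d` -/

/-- A coordinate is bounded by the sup norm: `|xᵢ| ≤ ‖x‖`. -/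
theorem abs_coord_le_norm {d : ℕ} (x : Site d) (i : Fin d) : |((x i : ℤ) : ℝ)| ≤ ‖x‖ := by
  have h := norm_le_pi_norm x i
  rwa [Int.norm_eq_abs] at h

/-- The sup norm is bounded by the Euclidean norm: `‖x‖ ≤ (Σᵢ xᵢ²)^{1/2}`. -/
theorem norm_le_sqrt_sum_sq {d : ℕ} (x : Site d) : ‖x‖ ≤ Real.sqrt (∑ i, ((x i : ℤ) : ℝ) ^ 2) := by
  refine (pi_norm_le_iff_of_nonneg (Real.sqrt_nonneg _)).2 fun i => ?_
  rw [Int.norm_eq_abs, ← Real.sqrt_sq_eq_abs]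
  exact Real.sqrt_le_sqrt (Finset.single_le_sum (f := fun j => ((x j : ℤ) : ℝ) ^ 2) (fun j _ => sq_nonneg _)
    (Finset.mem_univ i))

/-- A nonzero lattice point has sup norm at least `1`. -/
theorem one_le_norm_of_ne_zero {d : ℕ} {x : Site d} (hx : x ≠ 0) : 1 ≤ ‖x‖ := by
  obtain ⟨i, hi⟩ := Function.ne_iff.1 hx
  have h1 : (1 : ℝ) ≤ |((x i : ℤ) : ℝ)| := by
    have : (1 : ℤ) ≤ |x i| := Int.one_le_abs hi
    exact_mod_cast this
  exact h1.trans (abs_coord_le_norm x i)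

/-- A lattice point of sup norm `≥ 1` … is nonzero (contrapositive form used for shifted points). -/
theorem ne_zero_of_norm_pos {d : ℕ} {x : Site d} (hx : 0 < ‖x‖) : x ≠ 0 := by
  rintro rfl; simp at hx

/-- Conversion of the tree's Euclidean decay rates to sup-norm rates: for `x ≠ 0` and `s = −m`,
`(Σ xᵢ²)^{s/2} ≤ 1/‖x‖^m`. -/
theorem sqrt_rpow_le_inv_norm_pow {d : ℕ} {x : Site d} (hx : x ≠ 0) (m : ℕ) {s : ℝ} (hs : s = -(m : ℝ)) :
    Real.sqrt (∑ i, ((x i : ℤ) : ℝ) ^ 2) ^ s ≤ 1 / ‖x‖ ^ m := by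
  have h1 : 1 ≤ ‖x‖ := one_le_norm_of_ne_zero hx
  have h0 : 0 < ‖x‖ := by linarith
  have hR : ‖x‖ ≤ Real.sqrt (∑ i, ((x i : ℤ) : ℝ) ^ 2) := norm_le_sqrt_sum_sq x
  have hR0 : 0 < Real.sqrt (∑ i, ((x i : ℤ) : ℝ) ^ 2) := lt_of_lt_of_le h0 hR
  rw [hs, Real.rpow_neg hR0.le, Real.rpow_natCast, one_div]
  exact inv_anti₀ (pow_pos h0 m) (pow_le_pow_left₀ h0.le hR m)

/-- `‖eᵢ‖ = 1`. -/
theorem norm_e {d : ℕ} (i : Fin d) : ‖(e i : Site d)‖ = 1 := by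
  simp [LatticeForm.e, Pi.norm_single]

/-! ## Lawler's bounds in sup-norm form (`d = 4`) -/

/-- **Gradient bound** (Lawler (1.36), tree `latticeGreen_gradient_bound`): `|G(x ± eᵢ) − G(x)| ≤ K/‖x‖³`, `x ≠ 0`. -/
theorem exists_latticeGreen_grad_bound : ∃ K : ℝ, 0 ≤ K ∧ ∀ x : Site 4, x ≠ 0 → ∀ i : Fin 4,
    |latticeGreen (x + e i) - latticeGreen x| ≤ K / ‖x‖ ^ 3 ∧
      |latticeGreen (x - e i) - latticeGreen x| ≤ K / ‖x‖ ^ 3 := by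
  obtain ⟨K, hK0, hK⟩ := latticeGreen_gradient_bound (d := 4) (by norm_num)
  obtain ⟨K', hK'0, hK'⟩ := latticeGreen_gradient_bound_neg (d := 4) (by norm_num)
  refine ⟨max K K', le_max_of_le_left hK0, fun x hx i => ⟨?_, ?_⟩⟩
  · refine (hK x hx i).trans ?_
    have h := sqrt_rpow_le_inv_norm_pow hx 3 (s := 1 - ((4 : ℕ) : ℝ)) (by norm_num)
    calc K * Real.sqrt (∑ j, ((x j : ℤ) : ℝ) ^ 2) ^ (1 - ((4 : ℕ) : ℝ)) ≤ K * (1 / ‖x‖ ^ 3) :=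
          mul_le_mul_of_nonneg_left h hK0
      _ ≤ max K K' * (1 / ‖x‖ ^ 3) := mul_le_mul_of_nonneg_right (le_max_left _ _) (by positivity)
      _ = max K K' / ‖x‖ ^ 3 := by ring
  · refine (hK' x hx i).trans ?_
    have h := sqrt_rpow_le_inv_norm_pow hx 3 (s := 1 - ((4 : ℕ) : ℝ)) (by norm_num)
    calc K' * Real.sqrt (∑ j, ((x j : ℤ) : ℝ) ^ 2) ^ (1 - ((4 : ℕ) : ℝ)) ≤ K' * (1 / ‖x‖ ^ 3) :=
          mul_le_mul_of_nonneg_left h hK'0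
      _ ≤ max K K' * (1 / ‖x‖ ^ 3) := mul_le_mul_of_nonneg_right (le_max_right _ _) (by positivity)
      _ = max K K' / ‖x‖ ^ 3 := by ring

/-- **Second-difference bound** (Lawler (1.37) size statement, tree `latticeGreen_second_diff_bound`):
`|G(x+eⱼ+eᵢ) − G(x+eⱼ) − G(x+eᵢ) + G(x)| ≤ K/‖x‖⁴` for `x ≠ 0`, `x + eⱼ ≠ 0`. -/
theorem exists_latticeGreen_hess_bound : ∃ K : ℝ, 0 ≤ K ∧ ∀ x : Site 4, x ≠ 0 → ∀ i j : Fin 4, x + e j ≠ 0 →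
    |latticeGreen (x + e j + e i) - latticeGreen (x + e j) - latticeGreen (x + e i) + latticeGreen x| ≤
      K / ‖x‖ ^ 4 := by
  obtain ⟨K, hK0, hK⟩ := latticeGreen_second_diff_bound (d := 4) (by norm_num)
  refine ⟨K, hK0, fun x hx i j hxj => (hK x hx i j hxj).trans ?_⟩
  have h := sqrt_rpow_le_inv_norm_pow hx 4 (s := -((4 : ℕ) : ℝ)) (by norm_num)
  calc K * Real.sqrt (∑ k, ((x k : ℤ) : ℝ) ^ 2) ^ (-((4 : ℕ) : ℝ)) ≤ K * (1 / ‖x‖ ^ 4) :=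
        mul_le_mul_of_nonneg_left h hK0
    _ = K / ‖x‖ ^ 4 := by ring

/-! ## Pointwise decay of the co-potential `d₂ g_q` and of the curl kernel `d₁ div₂ g_q` -/

/-- The orientation factor of `greenTensor` is bounded by `1`. -/
theorem abs_orient_le_one {d : ℕ} (i j k l : Fin d) :
    |(if k = i ∧ l = j then (1 : ℝ) else 0) - (if k = j ∧ l = i then 1 else 0)| ≤ 1 := by
  split_ifs <;> norm_num

/-- **Decay of the co-potential**: `|(d₂ g_q)(y; a, b, c)| ≤ K_W/‖y − x_q‖³` for `y ≠ x_q`. -/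
theorem exists_d₂_greenTensor_bound : ∃ K : ℝ, 0 ≤ K ∧ ∀ (q : Plaq 4) (y : Site 4) (a b c : Fin 4),
    y ≠ q.1 → |d₂ (greenTensor q) y a b c| ≤ K / ‖y - q.1‖ ^ 3 := by
  obtain ⟨K, hK0, hK⟩ := exists_latticeGreen_grad_bound
  refine ⟨3 * K, by positivity, fun q y a b c hy => ?_⟩
  have hz : y - q.1 ≠ 0 := sub_ne_zero.2 hy
  set z := y - q.1 with hz'
  have hsh : ∀ m : Fin 4, y + e m - q.1 = z + e m := fun m => by rw [hz']; abel
  -- the three differences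
  have hdiff : ∀ (m : Fin 4) (k l : Fin 4),
      |greenTensor q (y + e m) k l - greenTensor q y k l| ≤ K / ‖z‖ ^ 3 / 2 := by
    intro m k l
    simp only [greenTensor, hsh]
    rw [show latticeGreen (z + e m) / 2 * ((if k = q.2.1 ∧ l = q.2.2 then (1 : ℝ) else 0) -
        (if k = q.2.2 ∧ l = q.2.1 then 1 else 0)) - latticeGreen z / 2 *
        ((if k = q.2.1 ∧ l = q.2.2 then (1 : ℝ) else 0) - (if k = q.2.2 ∧ l = q.2.1 then 1 else 0)) =
        (latticeGreen (z + e m) - latticeGreen z) / 2 *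
        ((if k = q.2.1 ∧ l = q.2.2 then (1 : ℝ) else 0) - (if k = q.2.2 ∧ l = q.2.1 then 1 else 0)) by ring,
      abs_mul, abs_div, abs_two]
    have h1 := (hK z hz m).1
    have h2 := abs_orient_le_one q.2.1 q.2.2 k l
    have h3 : 0 ≤ |latticeGreen (z + e m) - latticeGreen z| / 2 := by positivity
    calc |latticeGreen (z + e m) - latticeGreen z| / 2 *
          |(if k = q.2.1 ∧ l = q.2.2 then (1 : ℝ) else 0) - (if k = q.2.2 ∧ l = q.2.1 then 1 else 0)|
        ≤ |latticeGreen (z + e m) - latticeGreen z| / 2 * 1 := mul_le_mul_of_nonneg_left h2 h3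
      _ ≤ K / ‖z‖ ^ 3 / 2 := by linarith
  simp only [LatticeForm.d₂]
  have ha := hdiff a b c
  have hb := hdiff b a c
  have hc := hdiff c a b
  have htri : ∀ A B C : ℝ, |A - B + C| ≤ |A| + |B| + |C| := fun A B C => by
    calc |A - B + C| ≤ |A - B| + |C| := abs_add_le _ _
      _ ≤ |A| + |B| + |C| := by linarith [abs_sub A B]
  have h3 : 3 * K / ‖z‖ ^ 3 = 3 * (K / ‖z‖ ^ 3) := by ring
  rw [h3]
  have hk : 0 ≤ K / ‖z‖ ^ 3 := by positivity
  linarith [htri (greenTensor q (y + e a) b c - greenTensor q y b c) (greenTensor q (y + e b) a c - greenTensor q y a c)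
    (greenTensor q (y + e c) a b - greenTensor q y a b)]

/-- Sup-norm bookkeeping: for `‖w‖ ≥ 3` and unit vectors, `‖w − eₘ‖ ≥ 2`, `‖w − eₘ + e_l‖ ≥ 1`, and
`1/‖w − eₘ‖⁴ ≤ (81/16)/‖w‖⁴`. -/
theorem shift_norm_bounds {w : Site 4} (hw : 3 ≤ ‖w‖) (m l : Fin 4) :
    2 ≤ ‖w - e m‖ ∧ 1 ≤ ‖w - e m + e l‖ ∧ 1 / ‖w - e m‖ ^ 4 ≤ (81 / 16) / ‖w‖ ^ 4 := by
  have h1 : ‖w‖ - 1 ≤ ‖w - e m‖ := by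
    have := norm_sub_norm_le w (e m)
    rw [norm_e] at this
    linarith
  have h2 : ‖w - e m‖ - 1 ≤ ‖w - e m + e l‖ := by
    have := norm_sub_norm_le (w - e m) (-(e l))
    rw [norm_neg, norm_e, sub_neg_eq_add] at this
    linarith
  refine ⟨by linarith, by linarith, ?_⟩
  have hw0 : 0 < ‖w‖ := by linarith
  have h3 : 2 * ‖w‖ / 3 ≤ ‖w - e m‖ := by linarith
  have h4 : (2 * ‖w‖ / 3) ^ 4 ≤ ‖w - e m‖ ^ 4 := pow_le_pow_left₀ (by positivity) h3 4
  have hz0 : 0 < ‖w - e m‖ := by linarith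
  rw [div_le_div_iff₀ (pow_pos hz0 4) (pow_pos hw0 4)]
  nlinarith [h4, pow_pos hw0 4]

/-- **Decay of the shifted differences of `div₂ g_q`**: for `‖y − x_q‖ ≥ 3`,
`|(div₂ g_q)(y; k) − (div₂ g_q)(y + e_l; k)| ≤ K/‖y − x_q‖⁴` — each summand of `div₂` contributes a mixed second
difference of `G` at `y − eₘ − x_q`. -/
theorem exists_div₂_greenTensor_shift_bound : ∃ K : ℝ, 0 ≤ K ∧ ∀ (q : Plaq 4) (y : Site 4) (k l : Fin 4),
    3 ≤ ‖y - q.1‖ →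
      |div₂ (greenTensor q) y k - div₂ (greenTensor q) (y + e l) k| ≤ K / ‖y - q.1‖ ^ 4 := by
  obtain ⟨K, hK0, hK⟩ := exists_latticeGreen_hess_bound
  refine ⟨4 * ((81 / 16) * (K / 2)), by positivity, fun q y k l hy => ?_⟩
  set w := y - q.1 with hw
  have hterm : ∀ m : Fin 4,
      |(greenTensor q (y - e m) m k - greenTensor q y m k) -
          (greenTensor q (y + e l - e m) m k - greenTensor q (y + e l) m k)| ≤ (81 / 16) * (K / 2) / ‖w‖ ^ 4 := by
    intro m
    obtain ⟨hz2, hzl1, hzpow⟩ := shift_norm_bounds hy m l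
    set z := w - e m with hz
    have hz0 : z ≠ 0 := ne_zero_of_norm_pos (by linarith)
    have hzl0 : z + e l ≠ 0 := ne_zero_of_norm_pos (by linarith)
    have e1 : y - e m - q.1 = z := by rw [hz, hw]; abel
    have e2 : y - q.1 = z + e m := by rw [hz, hw]; abel
    have e3 : y + e l - e m - q.1 = z + e l := by rw [hz, hw]; abel
    have e4 : y + e l - q.1 = z + e l + e m := by rw [hz, hw]; abel
    simp only [greenTensor, e1, e3, e4]
    rw [e2]
    set ω : ℝ := (if m = q.2.1 ∧ k = q.2.2 then 1 else 0) - (if m = q.2.2 ∧ k = q.2.1 then 1 else 0) with hω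
    have halg : latticeGreen z / 2 * ω - latticeGreen (z + e m) / 2 * ω -
        (latticeGreen (z + e l) / 2 * ω - latticeGreen (z + e l + e m) / 2 * ω) =
        (latticeGreen (z + e l + e m) - latticeGreen (z + e l) - latticeGreen (z + e m) + latticeGreen z) / 2 * ω := by
      ring
    rw [halg, abs_mul, abs_div, abs_two]
    have hM := hK z hz0 m l hzl0
    have hω1 : |ω| ≤ 1 := abs_orient_le_one q.2.1 q.2.2 m k
    have hnn : 0 ≤ |latticeGreen (z + e l + e m) - latticeGreen (z + e l) - latticeGreen (z + e m) + latticeGreen z| / 2 := by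
      positivity
    calc |latticeGreen (z + e l + e m) - latticeGreen (z + e l) - latticeGreen (z + e m) + latticeGreen z| / 2 * |ω|
        ≤ |latticeGreen (z + e l + e m) - latticeGreen (z + e l) - latticeGreen (z + e m) + latticeGreen z| / 2 * 1 :=
          mul_le_mul_of_nonneg_left hω1 hnn
      _ ≤ K / ‖z‖ ^ 4 / 2 := by linarith
      _ = (K / 2) * (1 / ‖z‖ ^ 4) := by ring
      _ ≤ (K / 2) * ((81 / 16) / ‖w‖ ^ 4) := mul_le_mul_of_nonneg_left hzpow (by positivity)
      _ = (81 / 16) * (K / 2) / ‖w‖ ^ 4 := by ring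
  have hsplit : div₂ (greenTensor q) y k - div₂ (greenTensor q) (y + e l) k =
      ∑ m : Fin 4, ((greenTensor q (y - e m) m k - greenTensor q y m k) -
        (greenTensor q (y + e l - e m) m k - greenTensor q (y + e l) m k)) := by
    simp only [div₂, Finset.sum_sub_distrib]
  rw [hsplit]
  refine (Finset.abs_sum_le_sum_abs _ _).trans ?_
  calc ∑ m : Fin 4, |(greenTensor q (y - e m) m k - greenTensor q y m k) -
          (greenTensor q (y + e l - e m) m k - greenTensor q (y + e l) m k)|
      ≤ ∑ _m : Fin 4, (81 / 16) * (K / 2) / ‖w‖ ^ 4 := Finset.sum_le_sum fun m _ => hterm m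
    _ = 4 * ((81 / 16) * (K / 2)) / ‖w‖ ^ 4 := by
        rw [Finset.sum_const, Finset.card_univ, Fintype.card_fin, nsmul_eq_mul]
        push_cast
        ring

/-- **Decay of the `ℤ⁴` curl kernel**: `|(d₁ div₂ g_q)(y; k, l)| ≤ K_Z/‖y − x_q‖⁴` for `‖y − x_q‖ ≥ 3`
(`(d₁ div₂ g_q)(p) = curvatureTwoPoint p q`, a second difference of the lattice Green function). -/
theorem exists_curl_greenTensor_bound : ∃ K : ℝ, 0 ≤ K ∧ ∀ (q : Plaq 4) (y : Site 4) (k l : Fin 4),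
    3 ≤ ‖y - q.1‖ → |d₁ (div₂ (greenTensor q)) y k l| ≤ K / ‖y - q.1‖ ^ 4 := by
  obtain ⟨K, hK0, hK⟩ := exists_div₂_greenTensor_shift_bound
  refine ⟨2 * K, by positivity, fun q y k l hy => ?_⟩
  have h1 := hK q y k l hy
  have h2 := hK q y l k hy
  have hd : d₁ (div₂ (greenTensor q)) y k l =
      (div₂ (greenTensor q) y k - div₂ (greenTensor q) (y + e l) k) -
        (div₂ (greenTensor q) y l - div₂ (greenTensor q) (y + e k) l) := by
    simp only [LatticeForm.d₁]; ring
  rw [hd]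
  calc |(div₂ (greenTensor q) y k - div₂ (greenTensor q) (y + e l) k) -
        (div₂ (greenTensor q) y l - div₂ (greenTensor q) (y + e k) l)|
      ≤ |div₂ (greenTensor q) y k - div₂ (greenTensor q) (y + e l) k| +
        |div₂ (greenTensor q) y l - div₂ (greenTensor q) (y + e k) l| := abs_sub _ _
    _ ≤ K / ‖y - q.1‖ ^ 4 + K / ‖y - q.1‖ ^ 4 := add_le_add h1 h2
    _ = 2 * K / ‖y - q.1‖ ^ 4 := by ring

/-- Away from the plaquette, the co-exact part is minus the curl part: `(div₃ d₂ g_q)(y; k, l) = −(d₁ div₂ g_q)(y; k, l)`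
for `y ≠ x_q` (the Hodge split `d₁ div₂ g_q + div₃ d₂ g_q = δ_q`). -/
theorem div₃_d₂_greenTensor_of_ne (q : Plaq 4) {y : Site 4} (hy : y ≠ q.1) (k l : Fin 4) :
    div₃ (d₂ (greenTensor q)) y k l = -d₁ (div₂ (greenTensor q)) y k l := by
  have h := congrFun (congrFun (congrFun (div₃_d₂_add_d₁_div₂ (greenTensor q)) y) k) l
  simp only [Pi.add_apply] at h
  have hP : negLap₂ (greenTensor q) y k l = 0 := by
    -- `−Δ g_q` is supported at the site of `q`
    have hL := latticeLaplacianZd_half_latticeGreen 4 (by norm_num) (y - q.1)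
    have hne : y - q.1 ≠ 0 := sub_ne_zero.2 hy
    rw [if_neg hne, neg_zero] at hL
    set ω : ℝ := (if k = q.2.1 ∧ l = q.2.2 then 1 else 0) - (if k = q.2.2 ∧ l = q.2.1 then 1 else 0) with hω
    have e1 : ∀ m : Fin 4, y + e m - q.1 = y - q.1 + e m := fun m => by abel
    have e2 : ∀ m : Fin 4, y - e m - q.1 = y - q.1 - e m := fun m => by abel
    have hsum : negLap₂ (greenTensor q) y k l = ω * ∑ m : Fin 4,
        ((latticeGreen (y - q.1) / 2 - latticeGreen (y - q.1 + e m) / 2) +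
          (latticeGreen (y - q.1) / 2 - latticeGreen (y - q.1 - e m) / 2)) := by
      simp only [negLap₂, greenTensor, Finset.mul_sum, e1, e2]
      exact Finset.sum_congr rfl fun m _ => by ring
    have hlap : ∑ m : Fin 4, ((latticeGreen (y - q.1) / 2 - latticeGreen (y - q.1 + e m) / 2) +
        (latticeGreen (y - q.1) / 2 - latticeGreen (y - q.1 - e m) / 2)) =
        -latticeLaplacianZd (fun z => latticeGreen z / 2) (y - q.1) := by
      simp only [latticeLaplacianZd, LatticeForm.e, Finset.sum_add_distrib, Finset.sum_sub_distrib, Finset.sum_const,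
        Finset.card_univ, Fintype.card_fin, nsmul_eq_mul]
      ring
    rw [hsum, hlap, hL, neg_zero, mul_zero]
  linarith

end Summit.QuantumFields.YangMills.Theorems.WeakCouplingRates

end
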